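import Literature.Computability.AlgebraicComplexity.BI17GenericPeriodPolystableWitnessProofs
import Literature.Computability.Complexity.OccurrenceObstructionsIPSquareValues
import Literature.RepresentationTheory.FiniteGroups.SymmetricGroupKroneckerSquareSelfConjugate
import Literature.Computability.AlgebraicComplexity.BLMW11StanleyRectangularCharacterProofs
import Literature.Computability.AlgebraicComplexity.BI17Ex55KroneckerTable
import Literature.Computability.AlgebraicComplexity.BI17Rem54OfBLMW11Prop81
import HarnessLib

/-!
# Bürgisser–Ikenmeyer 2017, Thm. 4.2 and Cor. 5.12 (2) for every ODD `m ≥ 3` — PROOFS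
# (square Kronecker positivity `k_m(m) > 0`, no Popov, no Luna)

P. Bürgisser, C. Ikenmeyer, *Fundamental invariants of orbit closures*, J. Algebra **477** (2017)
390–434 = arXiv:1511.02927 [BurgisserIkenmeyer2017], Thm. 4.2 (TeX L1612: "`a(m) = 1` for `m ≥ 3`")
and Cor. 5.12 (2) (L2227: "`\overline{Gw}` is not normal for almost all `w ∈ ⊗³ℂ^m`", `m ≥ 3`).
THEOREMS ONLY; sibling of `BI17GenericPeriodPolystableWitnessProofs.lean` (the witness / odd-exponent
criteria and the BB04-shaped reductions `BI2017_thm_4_2_odd_of_kronRect_self_pos`,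
`BI2017_cor_5_12_part2_odd_of_kronRect_self_pos`) and of the statement file
`BI17FundamentalInvariantTensors.lean` (val-lit row BI2017-B), whose named facts `BI2017_thm_4_2`,
`BI2017_cor_5_12` are NOT restated. No new definition, no new named fact.

The input `k_m(m) = g(m × m, m × m, m × m) > 0` (Bessenrodt–Behns 2004, Cor. 3.2 / Remark p. 136:
"for a square partition `λ = (a^a)` the character `[a^a]` is a constituent in its Kronecker square")
is a THEOREM of the tree: `ikenmeyerPanova2017_square_pos_holds`
(`Literature/Computability/Complexity/OccurrenceObstructionsIPSquareValues.lean`, from Frobenius's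
character formula and Bessenrodt–Behns' `A_n`-argument). For odd `m` the exponent `δ = m` is odd, so
the sibling's `isZariskiGenericTensor_period_eq_one_of_odd_kronRect_pos` /
`…_not_isIntegrallyClosed_of_odd_kronRect_pos` apply (the unit tensor `⟨m⟩` supplying the
difference `2`, Bezout, then the coprime-degrees criterion and the Reynolds-free Thm. 5.8 (3) core).

## Main statements (ours — the print uses Popov's theorem / Luna's slices for every `m ≥ 4`)

* `kronRect_self_pos` — `k_m(m) > 0` for all `m ≥ 1` (in the `kronRect` currency); also from the
  typed general Bessenrodt–Behns fact `BessenrodtBehns2004_cor_3_2` (`kronRect_self_pos_of_BB04`,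
  self-conjugacy of the square `transpose_rectangle_self`) — the by-name second route and the
  consumer of that fact; section `ConventionGuard` decides the fact's predicate outright at the
  squares `1 × 1`, `2 × 2`, `3 × 3` (`k_1(1) = k_2(2) = k_3(3) = 1`, tree values).
* **`BI2017_thm_4_2_odd`** — `a(m) = 1` for every ODD `m ≥ 3`, PROVED.
* **`BI2017_cor_5_12_part2_odd`** — Cor. 5.12 (2) for every ODD `m ≥ 3`, PROVED (no Prop. 4.10).
* `BI2017_thm_4_2_of_lt_ten`, `BI2017_cor_5_12_part2_of_lt_ten` — all `3 ≤ m ≤ 9`.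
* **`BI2017_thm_4_2_iff_even_nonsquare_ten_le`**, **`BI2017_cor_5_12_iff_even_nonsquare_ten_le`** —
  the two named facts are EQUIVALENT to their clauses for EVEN NON-SQUARE `m ≥ 10`
  (`10, 12, 14, 18, 20, …`), the honest residual range where the printed inputs (Popov 1987 for
  Thm. 4.2; Popov + Luna 1973 for Cor. 5.12 via Prop. 4.10) remain the only source;
  `BI2017_cor_5_12_of_thm_4_2_of_prop_4_10_even_nonsquare_ten_le` (by name from the two facts'
  residual clauses).

Honest framing: typed-literature proofs for the cell `val-lit` (LADDER-VALIANT V3, a known-results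
layer at a known separation); nothing here bears on VP versus VNP.

## References

* [BurgisserIkenmeyer2017] P. Bürgisser, C. Ikenmeyer, *Fundamental invariants of orbit closures*,
  J. Algebra 477 (2017) 390–434; arXiv:1511.02927, Thm. 4.2, Thm. 4.3, Cor. 4.9, eq. (5.2), Thm. 5.3,
  Cor. 5.12.
* [BessenrodtBehns2004] C. Bessenrodt, C. Behns, *On the Durfee size of Kronecker products of
  characters of the symmetric group and its double covers*, J. Algebra 280 (2004) 132–144, Cor. 3.2.
* [IkenmeyerPanova2017] C. Ikenmeyer, G. Panova, *Rectangular Kronecker coefficients and plethysms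
  in geometric complexity theory*, Adv. Math. 319 (2017), §1.1 (square positivity as quoted).
-/

noncomputable section

open MvPolynomial

namespace Literature.Computability.AlgebraicComplexity

open _root_.Literature.NumberTheory.DiophantineGeometry
open _root_.Literature.RepresentationTheory.FiniteGroups (BessenrodtBehns2004_cor_3_2)
open _root_.Literature.Computability.Complexity (ikenmeyerPanova2017_square_pos_holds)

/-! ### Square Kronecker positivity in the `kronRect` currency -/

section SquarePositivity

/-- **`k_m(m) = g(m × m, m × m, m × m) > 0` for every `m ≥ 1`** — the tree's theorem
`ikenmeyerPanova2017_square_pos_holds` (Bessenrodt–Behns 2004, Cor. 3.2, square case) read in BI's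
`kronRect`. [cite: BessenrodtBehns2004, Cor. 3.2] -/
theorem kronRect_self_pos (m : ℕ) (hm : 1 ≤ m) : 0 < kronRect ℂ m m :=
  ikenmeyerPanova2017_square_pos_holds m hm

/-- The square partition `(a^a)` is self-conjugate. [folklore] -/
private theorem transpose_rectangle_self (a : ℕ) :
    (Nat.Partition.rectangle a a).transpose = Nat.Partition.rectangle a a :=
  Nat.Partition.ext (parts_transpose_rectangle a a)

/-- `k_m(m) > 0` for every `m`, BY NAME from the typed general statement of Bessenrodt–Behns 2004,
Cor. 3.2 (`[λ] ∈ [λ]²` for self-conjugate `λ`; the square `m × m` is self-conjugate).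
[cite: BessenrodtBehns2004, Cor. 3.2] -/
theorem kronRect_self_pos_of_BB04 (h : BessenrodtBehns2004_cor_3_2) (m : ℕ) : 0 < kronRect ℂ m m :=
  (h (m * m) (Nat.Partition.rectangle m m) (transpose_rectangle_self m)).1

end SquarePositivity

/-! ### Thm. 4.2 and Cor. 5.12 (2) for every odd `m ≥ 3` -/

section OddFormats

/-- **BI 2017, Thm. 4.2 for every ODD `m ≥ 3`: `a(m) = 1` — PROVED without Popov's theorem.**
`k_m(m) > 0` (`kronRect_self_pos`) at the odd exponent `δ = m`, and the sibling's
`BI2017_thm_4_2_odd_of_kronRect_self_pos`. [cite: BurgisserIkenmeyer2017, Thm. 4.2] -/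
theorem BI2017_thm_4_2_odd (m : ℕ) (hodd : Odd m) (hm : 3 ≤ m) :
    IsZariskiGenericTensor fun w : Fin m → Fin m → Fin m → ℂ => tensorStabilizerPeriod w = 1 :=
  BI2017_thm_4_2_odd_of_kronRect_self_pos (fun m _ hm => kronRect_self_pos m (by omega)) m hodd hm

/-- **BI 2017, Cor. 5.12 (2) for every ODD `m ≥ 3` — PROVED without Prop. 4.10 / Popov / Luna.**
[cite: BurgisserIkenmeyer2017, Cor. 5.12 (2)] -/
theorem BI2017_cor_5_12_part2_odd (m : ℕ) (hodd : Odd m) (hm : 3 ≤ m) :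
    IsZariskiGenericTensor fun w : Fin m → Fin m → Fin m → ℂ =>
      ¬ IsIntegrallyClosed (TensorOrbitCoordRing w) :=
  BI2017_cor_5_12_part2_odd_of_kronRect_self_pos (fun m _ hm => kronRect_self_pos m (by omega)) m
    hodd hm

/-- **BI 2017, Thm. 4.2 for `3 ≤ m ≤ 9` — PROVED** (`3, 5, 7, 9` odd; `4, 6, 8` by the tree's
certificates; `4, 9` also squares). [cite: BurgisserIkenmeyer2017, Thm. 4.2] -/
theorem BI2017_thm_4_2_of_lt_ten (m : ℕ) (h3 : 3 ≤ m) (h10 : m < 10) :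
    IsZariskiGenericTensor fun w : Fin m → Fin m → Fin m → ℂ => tensorStabilizerPeriod w = 1 := by
  rcases Nat.even_or_odd m with he | ho
  · have h : m = 4 ∨ m = 6 ∨ m = 8 := by
      rcases he with ⟨r, rfl⟩
      omega
    rcases h with rfl | rfl | rfl
    · exact BI2017_thm_4_2_four
    · exact BI2017_thm_4_2_six
    · exact BI2017_thm_4_2_eight
  · exact BI2017_thm_4_2_odd m ho h3

/-- **BI 2017, Cor. 5.12 (2) for `3 ≤ m ≤ 9` — PROVED.** [cite: BurgisserIkenmeyer2017, Cor. 5.12 (2)] -/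
theorem BI2017_cor_5_12_part2_of_lt_ten (m : ℕ) (h3 : 3 ≤ m) (h10 : m < 10) :
    IsZariskiGenericTensor fun w : Fin m → Fin m → Fin m → ℂ =>
      ¬ IsIntegrallyClosed (TensorOrbitCoordRing w) := by
  rcases Nat.even_or_odd m with he | ho
  · have h : m = 4 ∨ m = 6 ∨ m = 8 := by
      rcases he with ⟨r, rfl⟩
      omega
    rcases h with rfl | rfl | rfl
    · exact BI2017_cor_5_12_part2_of_le_six 4 (by norm_num) (by norm_num)
    · exact BI2017_cor_5_12_part2_of_le_six 6 (by norm_num) (by norm_num)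
    · exact BI2017_cor_5_12_part2_eight
  · exact BI2017_cor_5_12_part2_odd m ho h3

end OddFormats

/-! ### The named facts reduced to EVEN non-square `m ≥ 10` -/

section Residual

/-- **`BI2017_thm_4_2` is equivalent to its clause for EVEN NON-SQUARE `m ≥ 10`**
(`m = 10, 12, 14, 18, 20, 22, 24, 26, 28, 30, …`): all other formats are theorems of the tree
(`m = 2`: period `2`; odd `m ≥ 3`, squares, `m ∈ {4, 6, 8}`: period `1`).
[cite: BurgisserIkenmeyer2017, Thm. 4.2] -/
theorem BI2017_thm_4_2_iff_even_nonsquare_ten_le :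
    BI2017_thm_4_2 ↔ ∀ m : ℕ, 10 ≤ m → Even m → ¬ IsSquare m →
      IsZariskiGenericTensor fun w : Fin m → Fin m → Fin m → ℂ => tensorStabilizerPeriod w = 1 :=
  ⟨fun h42 m hm _ _ => h42.1 m (by omega),
    fun h' => BI2017_thm_4_2_of_kronRect_self_pos_of_even_nonsquare_ten_le
      (fun m _ hm => kronRect_self_pos m (by omega)) h'⟩

/-- **`BI2017_cor_5_12` is equivalent to its part-2 clause for EVEN NON-SQUARE `m ≥ 10`**
(part 1 and all other formats of part 2 being theorems of the tree).
[cite: BurgisserIkenmeyer2017, Cor. 5.12] -/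
theorem BI2017_cor_5_12_iff_even_nonsquare_ten_le :
    BI2017_cor_5_12 ↔ ∀ m : ℕ, 10 ≤ m → Even m → ¬ IsSquare m →
      IsZariskiGenericTensor fun w : Fin m → Fin m → Fin m → ℂ =>
        ¬ IsIntegrallyClosed (TensorOrbitCoordRing w) := by
  refine ⟨fun h512 m hm _ _ => h512.2 m (by omega), fun h' => ?_⟩
  rw [BI2017_cor_5_12_iff_residual]
  intro m hm h8 hsq
  rcases Nat.even_or_odd m with he | ho
  · have h10 : 10 ≤ m := by
      rcases he with ⟨r, rfl⟩
      omega
    exact h' m h10 he hsq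
  · exact BI2017_cor_5_12_part2_odd m ho (by omega)

/-- **`BI2017_cor_5_12` from the residual clauses of Thm. 4.2 and Prop. 4.10 (EVEN non-square
`m ≥ 10`) alone.** [cite: BurgisserIkenmeyer2017, Cor. 5.12] -/
theorem BI2017_cor_5_12_of_thm_4_2_of_prop_4_10_even_nonsquare_ten_le
    (h42 : ∀ m : ℕ, 10 ≤ m → Even m → ¬ IsSquare m →
      IsZariskiGenericTensor fun w : Fin m → Fin m → Fin m → ℂ => tensorStabilizerPeriod w = 1)
    (h410 : ∀ m : ℕ, 10 ≤ m → Even m → ¬ IsSquare m →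
      IsZariskiGenericTensor (IsPolystableTensor : (Fin m → Fin m → Fin m → ℂ) → Prop)) :
    BI2017_cor_5_12 :=
  BI2017_cor_5_12_of_kronRect_self_pos_of_even_nonsquare_clauses_ten_le
    (fun m _ hm => kronRect_self_pos m (by omega)) h42 h410

/-- **`BI2017_cor_5_12` from the named fact `BI2017_thm_4_2` and the residual clause of Prop. 4.10
(EVEN non-square `m ≥ 10`).** [cite: BurgisserIkenmeyer2017, Cor. 5.12] -/
theorem BI2017_cor_5_12_of_thm_4_2_of_prop_4_10_ten_le (h42 : BI2017_thm_4_2)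
    (h410 : ∀ m : ℕ, 10 ≤ m → Even m → ¬ IsSquare m →
      IsZariskiGenericTensor (IsPolystableTensor : (Fin m → Fin m → Fin m → ℂ) → Prop)) :
    BI2017_cor_5_12 :=
  BI2017_cor_5_12_of_thm_4_2_of_prop_4_10_even_nonsquare_ten_le (fun m hm _ _ => h42.1 m (by omega))
    h410

end Residual

/-! ### Convention guard for the typed fact `BessenrodtBehns2004_cor_3_2` (small squares, decided) -/

section ConventionGuard

/-- **Convention guard, `λ = (1)`**: the quantified predicate of `BessenrodtBehns2004_cor_3_2`
holds OUTRIGHT at the square `1 × 1` — `(1)ᵗ = (1)`, `g((1),(1),(1)) = 1 > 0`, `1 ≡ 1 (mod 4)` —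
by the tree's value `k_1(1) = 1` (`kronRect_sq_eq_one`), pinning that the fact's `kroneckerCoeff ℂ`,
`Nat.Partition.rectangle` and `Nat.Partition.transpose` are the tree's.
[cite: BessenrodtBehns2004, Cor. 3.2] -/
theorem BessenrodtBehns2004_cor_3_2_guard_one :
    (Nat.Partition.rectangle 1 1).transpose = Nat.Partition.rectangle 1 1 ∧
      0 < kroneckerCoeff ℂ (Nat.Partition.rectangle 1 1) (Nat.Partition.rectangle 1 1)
        (Nat.Partition.rectangle 1 1) ∧
      kroneckerCoeff ℂ (Nat.Partition.rectangle 1 1) (Nat.Partition.rectangle 1 1)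
        (Nat.Partition.rectangle 1 1) % 4 = 1 := by
  have h : kronRect ℂ 1 1 = 1 := by simpa using kronRect_sq_eq_one ℂ 1
  rw [kronRect] at h
  exact ⟨transpose_rectangle_self 1, by rw [h]; exact one_pos, by rw [h]⟩

/-- **Convention guard, `λ = (2,2)`**: `(2,2)ᵗ = (2,2)`, `g((2,2),(2,2),(2,2)) = 1 > 0`,
`≡ 1 (mod 4)` — by the tree's value `k_2(2) = 1` (BI Rem. 5.4, `BI2017_rem_5_4_holds`).
[cite: BessenrodtBehns2004, Cor. 3.2] -/
theorem BessenrodtBehns2004_cor_3_2_guard_two :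
    (Nat.Partition.rectangle 2 2).transpose = Nat.Partition.rectangle 2 2 ∧
      0 < kroneckerCoeff ℂ (Nat.Partition.rectangle 2 2) (Nat.Partition.rectangle 2 2)
        (Nat.Partition.rectangle 2 2) ∧
      kroneckerCoeff ℂ (Nat.Partition.rectangle 2 2) (Nat.Partition.rectangle 2 2)
        (Nat.Partition.rectangle 2 2) % 4 = 1 := by
  have h : kronRect ℂ 2 2 = 1 := by simpa using BI2017_rem_5_4_holds.1 2
  rw [kronRect] at h
  exact ⟨transpose_rectangle_self 2, by rw [h]; exact one_pos, by rw [h]⟩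

/-- **Convention guard, `λ = (3,3,3)`**: `(3,3,3)ᵗ = (3,3,3)`, `g((3³),(3³),(3³)) = 1 > 0`
(Strassen's invariant, BI Ex. 5.5: `k_3(3) = 1`, tree certificate `kronRect_three_three`),
`≡ 1 (mod 4)`. [cite: BessenrodtBehns2004, Cor. 3.2] -/
theorem BessenrodtBehns2004_cor_3_2_guard_three :
    (Nat.Partition.rectangle 3 3).transpose = Nat.Partition.rectangle 3 3 ∧
      0 < kroneckerCoeff ℂ (Nat.Partition.rectangle 3 3) (Nat.Partition.rectangle 3 3)
        (Nat.Partition.rectangle 3 3) ∧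
      kroneckerCoeff ℂ (Nat.Partition.rectangle 3 3) (Nat.Partition.rectangle 3 3)
        (Nat.Partition.rectangle 3 3) % 4 = 1 := by
  have h : kronRect ℂ 3 3 = 1 := kronRect_three_three
  rw [kronRect] at h
  exact ⟨transpose_rectangle_self 3, by rw [h]; exact one_pos, by rw [h]⟩

/-- The three guards are literally instances of the fact's quantified predicate (squares `1, 2, 3`):
whatever `BessenrodtBehns2004_cor_3_2` asserts at these `λ` is TRUE in the tree.
[cite: BessenrodtBehns2004, Cor. 3.2] -/
theorem BessenrodtBehns2004_cor_3_2_guard :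
    (∀ k ∈ ({1, 2, 3} : Finset ℕ),
      (Nat.Partition.rectangle k k).transpose = Nat.Partition.rectangle k k →
        0 < kroneckerCoeff ℂ (Nat.Partition.rectangle k k) (Nat.Partition.rectangle k k)
            (Nat.Partition.rectangle k k) ∧
          kroneckerCoeff ℂ (Nat.Partition.rectangle k k) (Nat.Partition.rectangle k k)
            (Nat.Partition.rectangle k k) % 4 = 1) := by
  intro k hk _
  simp only [Finset.mem_insert, Finset.mem_singleton] at hk
  rcases hk with rfl | rfl | rfl
  · exact BessenrodtBehns2004_cor_3_2_guard_one.2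
  · exact BessenrodtBehns2004_cor_3_2_guard_two.2
  · exact BessenrodtBehns2004_cor_3_2_guard_three.2

end ConventionGuard

end Literature.Computability.AlgebraicComplexity

end
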